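import Mathlib.NumberTheory.Zsqrtd.GaussianInt
import Mathlib.NumberTheory.Multiplicity
import Mathlib.RingTheory.PrincipalIdealDomain
import Mathlib.Data.ZMod.Basic
import Mathlib.FieldTheory.Finite.Basic
import Mathlib.Tactic
import Literature.NumberTheory.QuadraticFields.GaussianPrimary
import HarnessLib

/-!
# The Lebesgue–Nagell equation `x² + 64 = pⁿ` for an odd prime `p`

Topic `Literature/NumberTheory/DiophantineGeometry`; namespace
`Literature.NumberTheory.DiophantineGeometry` (sub-namespace `LebesgueNagell64` for the lemmas).
THEOREMS ONLY — no definition, no named fact (D-0026).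

Main result (`sq_add_sixtyfour_eq_prime_pow`): if `p` is an odd prime and `x² + 64 = pⁿ` for an
integer `x` and `n : ℕ`, then `n = 1`, or `n = 2` and `p = 17` (`15² + 64 = 17²`).

This is the case "`y` an odd prime" of the value `C = 64` in J. H. E. Cohn's table of the
Lebesgue–Nagell equations `x² + C = yⁿ` [Cohn1993, §5: for `C = 64` the only solution with `n ≥ 3`
is `x = 8`, i.e. `8² + 64 = 2⁷`], which is the Diophantine input of B. Setzer's classification of
the elliptic curves of prime conductor with a rational point of order `2` [Setzer1975] (the
discriminant equation `A² + 64 = pⁿ` of the curve `y² = x³ + Ax² − 16x`; see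
`Literature/NumberTheory/EllipticCurves/NeumannSetzerCurves.lean`, whose named fact
`Setzer1975_primeConductor_rationalTwoTorsion` this file serves).

## Proof (elementary; Cohn's general `C = 64` entry is NOT needed for a prime power right-hand side)

* `n` even, `n = 2m`: `(p^m − x)(p^m + x) = 64` forces `p^m = 17` (`LebesgueNagell64.even_case`).
* `n` odd, by strong induction. Let `q` be a prime factor of `n`, `n = qk`. In `ℤ[i]` the coprime
  factors `x ± 8i` of `(p^k)^q` are `q`-th powers up to units, and the four units are `q`-th powers
  (`q` odd), so `x + 8i = cᵠ`, `c = a + bi` (`LebesgueNagell64.exists_pow_eq`; the technique of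
  V. A. Lebesgue, cf. [Schoof2009, Prop. 2.1] and the tree's `CatalanLebesgue.lean`). Then `b ∣ 8`
  (`c ≡ a (mod b)`), and `a² + b² = p^k` is odd: `|b| = 1` makes `a` even and `x = Re cᵠ` even;
  `|b| = 2, 4` contradict `b² ∣ 8 − q a^{q−1} b` (second-order binomial expansion,
  `sq_dvd_add_pow_sub_sub`); so `b = ±8`, `a` odd and `a² + 64 = p^k`, whence `k = 1` by induction
  (`k` is odd) — i.e. `n = q` is prime and `p = a² + 64`.
  - `b = 8`: a 2-adic computation in `ℤ[i]` (`LebesgueNagell64.false_of_pow_eq_pos`): with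
    `c̄ = a − 8i` one has `cⁿ − c̄ⁿ = 16i = c − c̄`, hence `c (c^{n−1} − c̄^{n−1}) = 16i (1 − c̄^{n−1})`;
    writing `n − 1 = 2^ρ m` (`m` odd, `ρ ≥ 1`), `c^{2^ρ} − c̄^{2^ρ} = 2^{4+ρ}·O·i` with `O` odd,
    `c^{n−1} − c̄^{n−1} = 2^{4+ρ} O i · T` with `T ≡ m (mod 8)`, and `2^{ρ+2} ∣ c̄^{n−1} − 1`; so
    `4 ∣ a O m`, absurd.
  - `b = −8`: reduce by the ring map `ℤ[i] → 𝔽₅`, `i ↦ 2` (`LebesgueNagell64.false_of_pow_eq_neg`):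
    `(a + 1)ⁿ − (a − 1)ⁿ = −2` in `𝔽₅` with `a ≢ ±1` (as `5 ∤ a² + 64 = p`) and `n` odd — impossible.

Numerical sanity check (session folder `work/check_cases.py`): no solutions of `x² + 64 = pˡ` with
`3 ≤ l ≤ 8`, `p < 3000`.

## References

* [Cohn1993] J. H. E. Cohn, *The diophantine equation x² + C = yⁿ*, Acta Arith. 65 (1993) 367–381,
  §2 (case (D), `b ∣ d`), §3 Lemmas 4–5, §5 (table: `C = 64`, only `x = 8`). Held:
  `paper:doi-10-4064-aa-65-4-367-381`.
* [Setzer1975] B. Setzer, *Elliptic curves of prime conductor*, J. London Math. Soc. (2) 10 (1975)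
  367–378 (not held; acq-03412).
* [Schoof2009] R. Schoof, *Catalan's Conjecture*, Universitext, Prop. 2.1 (Lebesgue's method in `ℤ[i]`).
-/

namespace Literature.NumberTheory.DiophantineGeometry

namespace LebesgueNagell64

open Zsqrtd

/-! ### Even exponents -/

/-- `(P − x)(P + x) = 64` with `P > 0` forces `P ∈ {8, 10, 17}` (the factorisations of `64` into two
factors of the same sign and parity). [folklore] -/
private theorem eq_of_mul_eq_sixtyfour {P x : ℤ} (hP : 0 < P) (h : (P - x) * (P + x) = 64) :
    P = 17 ∨ P = 10 ∨ P = 8 := by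
  obtain ⟨d, hd⟩ : ∃ d : ℤ, d = P - x := ⟨_, rfl⟩
  have hdP : d * (2 * P - d) = 64 := by rw [hd, show 2 * P - (P - x) = P + x by ring]; exact h
  have hpos : 0 < d := by
    rcases pos_and_pos_or_neg_and_neg_of_mul_pos (by rw [hdP]; norm_num : 0 < d * (2 * P - d))
      with ⟨h1, _⟩ | ⟨h1, h2⟩
    · exact h1
    · exfalso; linarith
  have hle : d ≤ 64 := Int.le_of_dvd (by norm_num) (Dvd.intro _ hdP)
  interval_cases d <;> omega

/-- **Even exponent.** If `p` is an odd prime and `x² + 64 = p^{2m}`, then `m = 1` and `p = 17`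
(`(p^m − x)(p^m + x) = 64`). [cite: Cohn1993, §1 ("The case in which n is even is easily treated")] -/
theorem even_case {p : ℕ} (hp : p.Prime) (hp2 : p ≠ 2) {m : ℕ} {x : ℤ}
    (h : x ^ 2 + 64 = (p : ℤ) ^ (2 * m)) : m = 1 ∧ p = 17 := by
  have hP0 : (0 : ℤ) < (p : ℤ) ^ m := by
    have : (0 : ℤ) < p := by exact_mod_cast hp.pos
    positivity
  have hmul : ((p : ℤ) ^ m - x) * ((p : ℤ) ^ m + x) = 64 := by
    have : ((p : ℤ) ^ m) ^ 2 = x ^ 2 + 64 := by rw [← pow_mul, mul_comm]; exact h.symm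
    linear_combination this
  have hcases := eq_of_mul_eq_sixtyfour hP0 hmul
  have hnat : p ^ m = 17 ∨ p ^ m = 10 ∨ p ^ m = 8 := by
    rcases hcases with h1 | h1 | h1 <;> [left; (right; left); (right; right)] <;> exact_mod_cast h1
  have hm0 : m ≠ 0 := by
    rintro rfl; rw [pow_zero] at hnat; omega
  rcases hnat with h17 | h10 | h8
  · have h17p : Nat.Prime 17 := by norm_num
    have := (Nat.Prime.pow_eq_iff h17p).mp h17
    exact ⟨this.2, this.1⟩
  · exfalso
    have hpd : p ∣ 10 := by rw [← h10]; exact dvd_pow_self p hm0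
    have h25 : p ∣ 2 * 5 := by simpa using hpd
    rcases (Nat.Prime.dvd_mul hp).mp h25 with h2 | h5
    · exact hp2 ((Nat.prime_dvd_prime_iff_eq hp Nat.prime_two).mp h2)
    · have hp5 : p = 5 := (Nat.prime_dvd_prime_iff_eq hp (by norm_num)).mp h5
      subst hp5
      -- `5^m = 10` is impossible (`2 ∣ 5^m`)
      have h2 : 2 ∣ 5 ^ m := by rw [h10]; norm_num
      have := Nat.Prime.dvd_of_dvd_pow Nat.prime_two h2
      omega
  · exfalso
    have hpd : p ∣ 2 ^ 3 := by
      rw [show (2 : ℕ) ^ 3 = 8 by norm_num, ← h8]; exact dvd_pow_self p hm0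
    exact hp2 ((Nat.prime_dvd_prime_iff_eq hp Nat.prime_two).mp (hp.dvd_of_dvd_pow hpd))

/-! ### `x + 8i` is a `q`-th power in `ℤ[i]` -/

/-- For odd `x`, `8 ∣ 1 − x²`. [folklore] -/
private theorem eight_dvd_one_sub_sq {x : ℤ} (hx : Odd x) : (8 : ℤ) ∣ 1 - x ^ 2 := by
  obtain ⟨k, rfl⟩ := hx
  obtain ⟨t, ht⟩ := (Int.even_mul_succ_self k).two_dvd
  exact ⟨-t, by linear_combination (-4 : ℤ) * ht⟩

/-- For odd `x` the Gaussian integers `x + 8i` and `x − 8i` are coprime (an explicit Bézout relation: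
their ideal contains `2x` and `16`, hence `2`, hence `x`, hence `1`).
[cite: Cohn1993, §2 (coprimality of the factors x ± √−C when (x, C) = 1)] -/
theorem isCoprime_mk_eight {x : ℤ} (hx : Odd x) :
    IsCoprime (⟨x, 8⟩ : GaussianInt) ⟨x, -8⟩ := by
  obtain ⟨m, hm⟩ := eight_dvd_one_sub_sq hx
  refine ⟨⟨x, -4 * (x ^ 2 + m ^ 2)⟩, ⟨8 * m * x, -4 * (x ^ 2 - m ^ 2)⟩, ?_⟩
  ext
  · simp only [Zsqrtd.re_add, Zsqrtd.re_mul, Zsqrtd.re_one]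
    linear_combination (-(1 + 8 * m)) * hm
  · simp only [Zsqrtd.im_add, Zsqrtd.im_mul, Zsqrtd.im_one]
    linear_combination (8 * x) * hm

/-- `(x + 8i)(x − 8i) = x² + 64` in `ℤ[i]`. [folklore] -/
private theorem mk_eight_mul_conj (x : ℤ) :
    (⟨x, 8⟩ : GaussianInt) * ⟨x, -8⟩ = ((x ^ 2 + 64 : ℤ) : GaussianInt) := by
  rw [Zsqrtd.intCast_val]; ext <;> simp <;> ring

/-- In `ℤ[i]` every unit is a `q`-th power when `q` is odd (`u = (u^q)^q`, as `u⁴ = 1`). [folklore] -/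
private theorem units_eq_pow_pow {q : ℕ} (hq : Odd q) (u : GaussianIntˣ) :
    (u : GaussianInt) = ((u : GaussianInt) ^ q) ^ q := by
  have h4 : (u : GaussianInt) ^ 4 = 1 := by
    rcases QuadraticFields.GaussianPrimary.eq_of_isUnit u.isUnit with h | h | h | h <;>
      (rw [h]; decide)
  obtain ⟨r, rfl⟩ := hq
  rw [← pow_mul, show (2 * r + 1) * (2 * r + 1) = 4 * (r ^ 2 + r) + 1 by ring, pow_add, pow_mul,
    h4, one_pow, one_mul, pow_one]

/-- **Lebesgue's step in `ℤ[i]`.** If `x` is odd, `q` is odd and `x² + 64 = y^q`, then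
`x + 8i = c^q` for some Gaussian integer `c` (coprimality of `x ± 8i`, unique factorisation in
`ℤ[i]`, and its units being `q`-th powers). [cite: Cohn1993, §2 case (D) and Theorem 1(a)] -/
theorem exists_pow_eq {x y : ℤ} {q : ℕ} (hx : Odd x) (hq : Odd q) (h : x ^ 2 + 64 = y ^ q) :
    ∃ c : GaussianInt, c ^ q = ⟨x, 8⟩ := by
  have hprod : (⟨x, 8⟩ : GaussianInt) * ⟨x, -8⟩ = (y : GaussianInt) ^ q := by
    rw [mk_eight_mul_conj, h, Int.cast_pow]
  obtain ⟨d, u, hdu⟩ := exists_associated_pow_of_mul_eq_pow' (isCoprime_mk_eight hx) hprod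
  refine ⟨d * (u : GaussianInt) ^ q, ?_⟩
  rw [mul_pow, ← units_eq_pow_pow hq u, hdu]

/-! ### Consequences of `c^q = x + 8i` -/

/-- `N(x + 8i) = x² + 64`. [folklore] -/
private theorem norm_mk_eight (x : ℤ) : (⟨x, 8⟩ : GaussianInt).norm = x ^ 2 + 64 := by
  rw [Zsqrtd.norm_def]; ring

/-- If `c^q = x + 8i` then `((Re c)² + (Im c)²)^q = x² + 64` (norms). [folklore] -/
private theorem norm_eq_of_pow_eq {c : GaussianInt} {q : ℕ} {x : ℤ} (hc : c ^ q = ⟨x, 8⟩) :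
    (c.re ^ 2 + c.im ^ 2) ^ q = x ^ 2 + 64 := by
  have hn := congrArg Zsqrtd.norm hc
  rw [QuadraticFields.GaussianPrimary.norm_pow', norm_mk_eight, Zsqrtd.norm_def] at hn
  rw [← hn]; ring

/-- `Im c ∣ c − Re c` in `ℤ[i]` (`c − Re c = (Im c)·i`). [folklore] -/
private theorem im_dvd_sub_re (c : GaussianInt) :
    ((c.im : ℤ) : GaussianInt) ∣ c - ((c.re : ℤ) : GaussianInt) :=
  ⟨⟨0, 1⟩, by ext <;> simp⟩

/-- If `c^q = x + 8i` then `Im c ∣ 8` (`c ≡ Re c (mod Im c)`, so `c^q ≡ (Re c)^q`, whose imaginary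
part vanishes). [cite: Cohn1993, §2 (case (D): "it follows that b divides d")] -/
theorem im_dvd_eight {c : GaussianInt} {q : ℕ} {x : ℤ} (hc : c ^ q = ⟨x, 8⟩) : c.im ∣ 8 := by
  have h1 : ((c.im : ℤ) : GaussianInt) ∣ c ^ q - ((c.re : ℤ) : GaussianInt) ^ q :=
    dvd_trans (im_dvd_sub_re c) (sub_dvd_pow_sub_pow _ _ q)
  rw [hc, ← Int.cast_pow, Zsqrtd.intCast_dvd] at h1
  have h2 := h1.2
  rwa [Zsqrtd.im_sub, Zsqrtd.im_intCast, sub_zero] at h2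

/-- If `c^q = x + 8i` with `q` odd and `Re c` even, then `x` is even (`c ≡ (Im c) i (mod 2)` and
`((Im c) i)^q` has real part `0`). [folklore] -/
private theorem even_of_pow_eq_of_even_re {c : GaussianInt} {q : ℕ} {x : ℤ} (hq : Odd q)
    (hc : c ^ q = ⟨x, 8⟩) (ha : Even c.re) : Even x := by
  obtain ⟨k, hk⟩ := hq
  obtain ⟨t, ht⟩ := ha
  -- `2 ∣ c - (Im c) i`
  have h2 : ((2 : ℤ) : GaussianInt) ∣ c - ⟨0, c.im⟩ := ⟨⟨t, 0⟩, by ext <;> simp [ht, two_mul]⟩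
  have h3 : ((2 : ℤ) : GaussianInt) ∣ c ^ q - (⟨0, c.im⟩ : GaussianInt) ^ q :=
    dvd_trans h2 (sub_dvd_pow_sub_pow _ _ q)
  -- the real part of `((Im c) i)^q` vanishes for odd `q`
  have hsq : (⟨0, c.im⟩ : GaussianInt) ^ 2 = ((-c.im ^ 2 : ℤ) : GaussianInt) := by
    ext <;> simp [sq]
  have hre : ((⟨0, c.im⟩ : GaussianInt) ^ q).re = 0 := by
    rw [hk, pow_succ, pow_mul, hsq, ← Int.cast_pow, Zsqrtd.re_mul, Zsqrtd.re_intCast,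
      Zsqrtd.im_intCast]
    ring
  rw [Zsqrtd.intCast_dvd] at h3
  have h4 := h3.1
  rw [Zsqrtd.re_sub, hc, hre, sub_zero] at h4
  exact even_iff_two_dvd.mpr h4

/-- If `c^q = x + 8i` then `(Im c)² ∣ 8 − q (Re c)^{q−1} (Im c)` (the binomial expansion of
`(a + bi)^q` to second order in `bi`, Mathlib's `sq_dvd_add_pow_sub_sub`).
[cite: Cohn1993, §2 (equating imaginary parts in (D))] -/
theorem sq_im_dvd {c : GaussianInt} {q : ℕ} {x : ℤ} (hc : c ^ q = ⟨x, 8⟩) :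
    c.im ^ 2 ∣ 8 - q * c.re ^ (q - 1) * c.im := by
  have h := sq_dvd_add_pow_sub_sub (⟨0, c.im⟩ : GaussianInt) ((c.re : ℤ) : GaussianInt) q
  have hca : ((c.re : ℤ) : GaussianInt) + ⟨0, c.im⟩ = c := by ext <;> simp
  have hsq : (⟨0, c.im⟩ : GaussianInt) ^ 2 = ((-c.im ^ 2 : ℤ) : GaussianInt) := by
    ext <;> simp [sq]
  have hq : (q : GaussianInt) = ((q : ℤ) : GaussianInt) := by simp
  rw [hca, hsq, hc, hq, ← Int.cast_pow, ← Int.cast_pow, Zsqrtd.intCast_dvd] at h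
  have h2 := h.2
  simp only [Zsqrtd.im_sub, Zsqrtd.im_mul, Zsqrtd.re_mul, Zsqrtd.re_intCast,
    Zsqrtd.im_intCast, mul_zero, zero_mul, zero_add, add_zero, sub_zero] at h2
  have h3 : -c.im ^ 2 ∣ 8 - q * c.re ^ (q - 1) * c.im := by
    have e : (8 : ℤ) - q * c.re ^ (q - 1) * c.im = 8 - c.re ^ (q - 1) * c.im * q := by ring
    rw [e]; exact h2
  exact neg_dvd.mp h3

/-- **The shape of `c`.** If `q` is odd, `x` is odd, `c^q = x + 8i` and `(Re c)² + (Im c)²` is odd,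
then `Im c = ±8` and `Re c` is odd. (`Im c ∣ 8`; `|Im c| = 1` would make `Re c` and then `x`
even; `|Im c| ∈ {2, 4}` contradicts `(Im c)² ∣ 8 − q (Re c)^{q−1} Im c` with `q (Re c)^{q−1}`
odd.) [cite: Cohn1993, §2 (case (D)) and §3] -/
theorem im_eq_of_pow_eq {c : GaussianInt} {q : ℕ} {x : ℤ} (hq : Odd q) (hx : Odd x)
    (hc : c ^ q = ⟨x, 8⟩) (hodd : Odd (c.re ^ 2 + c.im ^ 2)) :
    (c.im = 8 ∨ c.im = -8) ∧ Odd c.re := by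
  have hb := im_dvd_eight hc
  have hb8 : c.im.natAbs ∣ 2 ^ 3 := by
    have := Int.natAbs_dvd_natAbs.mpr hb; simpa using this
  obtain ⟨i, hi, hbi⟩ := (Nat.dvd_prime_pow Nat.prime_two).mp hb8
  have hbcases : c.im = (2 : ℤ) ^ i ∨ c.im = -(2 : ℤ) ^ i := by
    rcases Int.natAbs_eq c.im with hh | hh <;> [left; right] <;> rw [hh, hbi] <;> push_cast <;> ring
  have hsq := sq_im_dvd hc
  have hb2 : c.im ^ 2 = ((2 : ℤ) ^ i) ^ 2 := by
    rcases hbcases with hh | hh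
    · rw [hh]
    · rw [hh]; ring
  -- parity of `Re c` from the parity of `(Re c)² + (Im c)²`
  have hpar : ∀ {e : ℤ}, Even e → c.im ^ 2 = e → Odd c.re := by
    intro e he hce
    rw [hce] at hodd
    by_contra hne
    rw [Int.not_odd_iff_even] at hne
    exact (Int.not_even_iff_odd.mpr hodd) ((hne.pow_of_ne_zero two_ne_zero).add he)
  interval_cases i
  · -- `|b| = 1`: `a` even, contradiction with `x` odd
    exfalso
    have hb1 : c.im ^ 2 = 1 := by rw [hb2]; norm_num
    have ha : Even c.re := by
      have h1 : Odd (c.re ^ 2 + 1) := by rw [hb1] at hodd; exact hodd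
      by_contra hne
      rw [Int.not_even_iff_odd] at hne
      exact (Int.not_even_iff_odd.mpr h1) ((hne.pow).add_odd odd_one)
    exact (Int.not_even_iff_odd.mpr hx) (even_of_pow_eq_of_even_re hq hc ha)
  · -- `|b| = 2`
    exfalso
    have ha : Odd c.re := hpar (e := 4) ⟨2, by norm_num⟩ (by rw [hb2]; norm_num)
    obtain ⟨t, ht⟩ := (show Odd (q : ℤ) by exact_mod_cast hq).mul (ha.pow (n := q - 1))
    have hb' : c.im = 2 ∨ c.im = -2 := by
      rcases hbcases with hh | hh <;> [left; right] <;> rw [hh] <;> norm_num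
    rw [ht] at hsq
    rcases hb' with hh | hh <;> (rw [hh] at hsq; norm_num at hsq) <;> omega
  · -- `|b| = 4`
    exfalso
    have ha : Odd c.re := hpar (e := 16) ⟨8, by norm_num⟩ (by rw [hb2]; norm_num)
    obtain ⟨t, ht⟩ := (show Odd (q : ℤ) by exact_mod_cast hq).mul (ha.pow (n := q - 1))
    have hb' : c.im = 4 ∨ c.im = -4 := by
      rcases hbcases with hh | hh <;> [left; right] <;> rw [hh] <;> norm_num
    rw [ht] at hsq
    rcases hb' with hh | hh <;> (rw [hh] at hsq; norm_num at hsq) <;> omega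
  · -- `|b| = 8`
    refine ⟨by rcases hbcases with hh | hh <;> [left; right] <;> rw [hh] <;> norm_num, ?_⟩
    exact hpar (e := 64) ⟨32, by norm_num⟩ (by rw [hb2]; norm_num)

/-! ### The sign `+`: a 2-adic computation in `ℤ[i]` -/

/-- `8 ∣ c^j − (Re c)^j` when `Im c = ±8` (`c ≡ Re c (mod 8)`). [folklore] -/
private theorem eight_dvd_pow_sub_pow {c : GaussianInt} (hb : c.im = 8 ∨ c.im = -8) (j : ℕ) :
    ((8 : ℤ) : GaussianInt) ∣ c ^ j - ((c.re ^ j : ℤ) : GaussianInt) := by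
  have h1 : ((8 : ℤ) : GaussianInt) ∣ c - ((c.re : ℤ) : GaussianInt) := by
    rcases hb with h | h
    · exact ⟨⟨0, 1⟩, by ext <;> simp [h]⟩
    · exact ⟨⟨0, -1⟩, by ext <;> simp [h]⟩
  rw [Int.cast_pow]
  exact dvd_trans h1 (sub_dvd_pow_sub_pow _ _ j)

/-- For odd `a` and `k ≥ 1`, `8 ∣ a^{2^k} − 1`. [folklore] -/
private theorem eight_dvd_pow_two_pow_sub_one {a : ℤ} (ha : Odd a) {k : ℕ} (hk : 1 ≤ k) :
    (8 : ℤ) ∣ a ^ (2 ^ k) - 1 := by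
  obtain ⟨k, rfl⟩ := Nat.exists_eq_add_of_le hk
  have h8 : (8 : ℤ) ∣ a ^ 2 - 1 := by
    have := eight_dvd_one_sub_sq ha
    rw [← neg_sub] at this; exact dvd_neg.mp this
  rw [show 1 + k = k + 1 by ring, pow_succ', pow_mul]
  exact dvd_trans h8 (by simpa using sub_dvd_pow_sub_pow (a ^ 2) 1 (2 ^ k))

/-- `z + star z = 2 Re z` in `ℤ[i]`. [folklore] -/
private theorem add_star_eq (z : GaussianInt) : z + star z = ((2 * z.re : ℤ) : GaussianInt) := by
  ext <;> simp [two_mul]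

/-- **Exact 2-divisibility of `c^{2^k} − c̄^{2^k}`.** If `c = a + 8i` with `a` odd, then for every `k`,
`c^{2^k} − c̄^{2^k} = 2^{4+k}·O·i` for an odd integer `O` (induction: the factor
`c^{2^k} + c̄^{2^k} = 2 Re c^{2^k}` is twice an odd integer). [folklore] -/
private theorem pow_two_pow_sub_star_pow {c : GaussianInt} (hb : c.im = 8) (ha : Odd c.re) (k : ℕ) :
    ∃ O : ℤ, Odd O ∧ c ^ (2 ^ k) - (star c) ^ (2 ^ k) = ⟨0, 2 ^ (4 + k) * O⟩ := by
  induction k with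
  | zero =>
    refine ⟨1, odd_one, ?_⟩
    ext <;> simp [hb]
  | succ k ih =>
    obtain ⟨O, hO, hk⟩ := ih
    -- the real part of `c^{2^k}` is odd
    have hre : Odd (c ^ (2 ^ k)).re := by
      have h8 := eight_dvd_pow_sub_pow (Or.inl hb) (2 ^ k)
      rw [Zsqrtd.intCast_dvd] at h8
      have h8re : (8 : ℤ) ∣ (c ^ 2 ^ k).re - c.re ^ 2 ^ k := by
        have h81 := h8.1
        rwa [Zsqrtd.re_sub, Zsqrtd.re_intCast] at h81
      obtain ⟨t, ht⟩ := h8re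
      have e : (c ^ 2 ^ k).re = c.re ^ 2 ^ k + 8 * t := by linarith
      rw [e]
      exact (ha.pow).add_even ⟨4 * t, by ring⟩
    obtain ⟨R, hR⟩ := hre
    refine ⟨O * (c ^ (2 ^ k)).re, hO.mul ⟨R, hR⟩, ?_⟩
    have hfac : c ^ (2 ^ (k + 1)) - (star c) ^ (2 ^ (k + 1)) =
        (c ^ (2 ^ k) - (star c) ^ (2 ^ k)) * (c ^ (2 ^ k) + (star c) ^ (2 ^ k)) := by
      rw [pow_succ, pow_mul, pow_mul]; ring
    rw [hfac, hk, ← star_pow, add_star_eq]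
    ext
    · simp
    · simp; ring

/-- If `c = a ± 8i` with `a` odd and `k ≥ 1`, then `8 ∣ c^{2^k·j} − 1` for every `j`
(`c^{2^k} ≡ a^{2^k} ≡ 1 (mod 8)`). [folklore] -/
private theorem eight_dvd_pow_sub_one {c : GaussianInt} (hb : c.im = 8 ∨ c.im = -8) (ha : Odd c.re)
    {k : ℕ} (hk : 1 ≤ k) (j : ℕ) : ((8 : ℤ) : GaussianInt) ∣ c ^ (2 ^ k * j) - 1 := by
  have h1 : ((8 : ℤ) : GaussianInt) ∣ c ^ (2 ^ k) - 1 := by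
    have hA := eight_dvd_pow_sub_pow hb (2 ^ k)
    have hB : ((8 : ℤ) : GaussianInt) ∣ ((c.re ^ (2 ^ k) : ℤ) : GaussianInt) - 1 := by
      have := eight_dvd_pow_two_pow_sub_one ha hk
      rw [show (1 : GaussianInt) = ((1 : ℤ) : GaussianInt) by simp, ← Int.cast_sub,
        Zsqrtd.intCast_dvd_intCast]
      exact this
    have := dvd_add hA hB
    simpa using this
  rw [pow_mul]
  exact dvd_trans h1 (by simpa using sub_dvd_pow_sub_pow (c ^ (2 ^ k)) 1 j)

/-- If `c = a ± 8i` with `a` odd, `m` arbitrary and `k ≥ 1`, then `2^{k+2} ∣ c^{2^k m} − 1`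
(`c^{2m} ≡ 1 (mod 8)`, and each further squaring gains a factor `2`:
`u² − 1 = (u − 1)(u + 1)` with `u + 1` even). [folklore] -/
private theorem two_pow_dvd_pow_sub_one {c : GaussianInt} (hb : c.im = 8 ∨ c.im = -8) (ha : Odd c.re)
    (m : ℕ) {k : ℕ} (hk : 1 ≤ k) :
    ((2 : ℤ) : GaussianInt) ^ (k + 2) ∣ c ^ (2 ^ k * m) - 1 := by
  induction k with
  | zero => omega
  | succ k ih =>
    rcases Nat.eq_zero_or_pos k with rfl | hkpos
    · -- `k + 1 = 1`: `8 ∣ c^{2m} - 1`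
      have := eight_dvd_pow_sub_one hb ha (le_refl 1) m
      have e : ((2 : ℤ) : GaussianInt) ^ (0 + 1 + 2) = ((8 : ℤ) : GaussianInt) := by norm_num
      rw [e]; exact this
    · have hfac : c ^ (2 ^ (k + 1) * m) - 1 =
          (c ^ (2 ^ k * m) - 1) * (c ^ (2 ^ k * m) + 1) := by
        rw [show 2 ^ (k + 1) * m = (2 ^ k * m) * 2 by ring, pow_mul]; ring
      have h2 : ((2 : ℤ) : GaussianInt) ∣ c ^ (2 ^ k * m) + 1 := by
        have h8 := eight_dvd_pow_sub_one hb ha hkpos m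
        have e : c ^ (2 ^ k * m) + 1 = (c ^ (2 ^ k * m) - 1) + ((2 : ℤ) : GaussianInt) := by
          push_cast; ring
        rw [e]
        refine dvd_add (dvd_trans ⟨((4 : ℤ) : GaussianInt), by push_cast; norm_num⟩ h8) (dvd_refl _)
      rw [hfac, pow_succ]
      exact mul_dvd_mul (ih hkpos) h2

/-- `T = ∑_{j<m} C^j D^{m−1−j} ≡ m (mod 8)` when `C ≡ D ≡ 1 (mod 8)`. [folklore] -/
private theorem eight_dvd_geom_sum₂_sub {C D : GaussianInt} (hC : ((8 : ℤ) : GaussianInt) ∣ C - 1)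
    (hD : ((8 : ℤ) : GaussianInt) ∣ D - 1) (m : ℕ) :
    ((8 : ℤ) : GaussianInt) ∣
      (∑ j ∈ Finset.range m, C ^ j * D ^ (m - 1 - j)) - ((m : ℤ) : GaussianInt) := by
  have hterm : ∀ j ∈ Finset.range m,
      ((8 : ℤ) : GaussianInt) ∣ C ^ j * D ^ (m - 1 - j) - 1 := by
    intro j _
    have h1 : ((8 : ℤ) : GaussianInt) ∣ C ^ j - 1 :=
      dvd_trans hC (by simpa using sub_dvd_pow_sub_pow C 1 j)
    have h2 : ((8 : ℤ) : GaussianInt) ∣ D ^ (m - 1 - j) - 1 :=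
      dvd_trans hD (by simpa using sub_dvd_pow_sub_pow D 1 (m - 1 - j))
    have e : C ^ j * D ^ (m - 1 - j) - 1 = (C ^ j - 1) * D ^ (m - 1 - j) + (D ^ (m - 1 - j) - 1) := by
      ring
    rw [e]
    exact dvd_add (dvd_mul_of_dvd_left h1 _) h2
  have hsum : (∑ j ∈ Finset.range m, C ^ j * D ^ (m - 1 - j)) - ((m : ℤ) : GaussianInt) =
      ∑ j ∈ Finset.range m, (C ^ j * D ^ (m - 1 - j) - 1) := by
    rw [Finset.sum_sub_distrib]; simp
  rw [hsum]
  exact Finset.dvd_sum hterm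

/-- **The sign `+` is impossible.** There is no Gaussian integer `c = a + 8i` with `a` odd such that
`cⁿ = x + 8i` for some integer `x` and an odd `n ≥ 3`. (Equivalently: the Lucas-type quotient
`(cⁿ − c̄ⁿ)/(c − c̄)` is not `+1`; Cohn's Lemma 5 excludes the plus sign whenever `4 ∣ C`.)
Proof: `cⁿ − c̄ⁿ = 16i = c − c̄` gives `c (c^{n−1} − c̄^{n−1}) = 16i (1 − c̄^{n−1})`; with
`n − 1 = 2^ρ m`, `m` odd, `ρ ≥ 1`, the left side is `2^{4+ρ}·O·i·c·T` with `O` odd and `T ≡ m (mod 8)`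
while `2^{ρ+6}` divides the right side; cancelling, `4 ∣ a O m`, absurd.
[cite: Cohn1993, Lemma 5 (the case 4 ∣ C)] -/
theorem false_of_pow_eq_pos {c : GaussianInt} {n : ℕ} {x : ℤ} (hb : c.im = 8) (ha : Odd c.re)
    (hn : Odd n) (hn3 : 3 ≤ n) (hc : c ^ n = ⟨x, 8⟩) : False := by
  -- `n - 1 = 2^ρ m` with `m` odd and `ρ ≥ 1`
  obtain ⟨ρ, m, hm, hρm⟩ := Nat.exists_eq_two_pow_mul_odd (n := n - 1) (by omega)
  have hρ : 1 ≤ ρ := by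
    by_contra h0
    have h0' : ρ = 0 := by omega
    rw [h0', pow_zero, one_mul] at hρm
    obtain ⟨r, hr⟩ := hn; obtain ⟨s, hs⟩ := hm; omega
  set cb := star c with hcb
  have hb' : cb.im = 8 ∨ cb.im = -8 := Or.inr (by rw [hcb]; simp [hb])
  have ha' : Odd cb.re := by rw [hcb]; simpa using ha
  have hstar : cb ^ n = ⟨x, -8⟩ := by rw [hcb, ← star_pow, hc]; rfl
  -- `cⁿ − c̄ⁿ = c − c̄ (= 16 i)`
  have hdiff : c ^ n - cb ^ n = c - cb := by
    rw [hc, hstar, hcb]; ext <;> simp [hb]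
  -- key identity `c (c^{n-1} − c̄^{n-1}) = (c − c̄)(1 − c̄^{n-1})`
  have hkey : c * (c ^ (n - 1) - cb ^ (n - 1)) = (c - cb) * (1 - cb ^ (n - 1)) := by
    have e1 : c ^ n = c * c ^ (n - 1) := by rw [← pow_succ']; congr 1; omega
    have e2 : cb ^ n = cb * cb ^ (n - 1) := by rw [← pow_succ']; congr 1; omega
    linear_combination hdiff - e1 + e2
  -- left side: `c^{n-1} − c̄^{n-1} = (C − C̄) T`, `C = c^{2^ρ}`, `C − C̄ = 2^{4+ρ} O i`
  obtain ⟨O, hO, hCO⟩ := pow_two_pow_sub_star_pow hb ha ρ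
  rw [← hcb] at hCO
  set T := ∑ j ∈ Finset.range m, (c ^ (2 ^ ρ)) ^ j * (cb ^ (2 ^ ρ)) ^ (m - 1 - j) with hT
  have hgeom : c ^ (n - 1) - cb ^ (n - 1) = (⟨0, 2 ^ (4 + ρ) * O⟩ : GaussianInt) * T := by
    rw [hρm, pow_mul, pow_mul, ← hCO, hT, mul_comm]
    exact (geom_sum₂_mul _ _ m).symm
  -- `T ≡ m (mod 8)`
  have hT8 : ((8 : ℤ) : GaussianInt) ∣ T - ((m : ℤ) : GaussianInt) := by
    apply eight_dvd_geom_sum₂_sub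
    · simpa using eight_dvd_pow_sub_one (Or.inl hb) ha hρ 1
    · simpa using eight_dvd_pow_sub_one hb' ha' hρ 1
  obtain ⟨τ, hτ⟩ := hT8
  -- right side: `2^{ρ+2} ∣ 1 − c̄^{n-1}`
  have hR : ((2 : ℤ) : GaussianInt) ^ (ρ + 2) ∣ 1 - cb ^ (n - 1) := by
    have := two_pow_dvd_pow_sub_one hb' ha' m hρ
    rw [← hρm] at this
    rw [← neg_sub]; exact dvd_neg.mpr this
  -- so `2^{ρ+6} ∣ c · 2^{4+ρ} O i · T`, i.e. `4 ∣ c · (O i) · T`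
  have hccb : c - cb = ((16 : ℤ) : GaussianInt) * ⟨0, 1⟩ := by
    rw [hcb, Zsqrtd.smul_val]; ext <;> simp [hb]
  have h16 : ((16 : ℤ) : GaussianInt) = ((2 : ℤ) : GaussianInt) ^ 4 := by
    rw [← Int.cast_pow]; norm_num
  have h1 : ((2 : ℤ) : GaussianInt) ^ 4 * ((2 : ℤ) : GaussianInt) ^ (ρ + 2) ∣
      c * (c ^ (n - 1) - cb ^ (n - 1)) := by
    rw [hkey, hccb, mul_assoc, h16]
    exact mul_dvd_mul_left _ (dvd_mul_of_dvd_right hR _)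
  have e : c * (c ^ (n - 1) - cb ^ (n - 1)) =
      ((2 : ℤ) : GaussianInt) ^ (4 + ρ) * (c * ⟨0, O⟩ * T) := by
    rw [hgeom]
    have : (⟨0, 2 ^ (4 + ρ) * O⟩ : GaussianInt) = ((2 : ℤ) : GaussianInt) ^ (4 + ρ) * ⟨0, O⟩ := by
      rw [← Int.cast_pow, Zsqrtd.smul_val]; ext <;> simp
    rw [this]; ring
  rw [e, show ((2 : ℤ) : GaussianInt) ^ 4 * ((2 : ℤ) : GaussianInt) ^ (ρ + 2) =
    ((2 : ℤ) : GaussianInt) ^ (4 + ρ) * ((2 : ℤ) : GaussianInt) ^ 2 by ring] at h1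
  have h2ne : ((2 : ℤ) : GaussianInt) ^ (4 + ρ) ≠ 0 := pow_ne_zero _ (by decide)
  have h4 : ((2 : ℤ) : GaussianInt) ^ 2 ∣ c * ⟨0, O⟩ * T := (mul_dvd_mul_iff_left h2ne).mp h1
  -- `T = m + 8 τ`
  have hT' : T = ((m : ℤ) : GaussianInt) + ((8 : ℤ) : GaussianInt) * τ := by
    linear_combination hτ
  rw [hT', mul_add, show c * ⟨0, O⟩ * (((8 : ℤ) : GaussianInt) * τ) =
    ((2 : ℤ) : GaussianInt) ^ 2 * (2 * (c * ⟨0, O⟩ * τ)) by push_cast; ring] at h4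
  have h5 : ((2 : ℤ) : GaussianInt) ^ 2 ∣ c * ⟨0, O⟩ * ((m : ℤ) : GaussianInt) :=
    (dvd_add_left (dvd_mul_right _ _)).mp h4
  -- imaginary part: `4 ∣ a O m`
  have hprod : c * ⟨0, O⟩ * ((m : ℤ) : GaussianInt) = ⟨-(8 * O * m), c.re * O * m⟩ := by
    ext <;> simp [hb]
  rw [← Int.cast_pow, hprod, Zsqrtd.intCast_dvd] at h5
  obtain ⟨-, h7⟩ := h5
  have h7' : (4 : ℤ) ∣ c.re * O * (m : ℤ) := by simpa using h7
  have hodd : Odd (c.re * O * (m : ℤ)) := (ha.mul hO).mul (by exact_mod_cast hm)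
  obtain ⟨r, hr⟩ := hodd
  omega

/-! ### The sign `−`: reduction modulo `5` -/

/-- `2·2 = −1` in `𝔽₅`: the ring map `ℤ[i] → 𝔽₅`, `i ↦ 2` exists. [folklore] -/
private theorem two_mul_two_zmod_five : (2 : ZMod 5) * 2 = ((-1 : ℤ) : ZMod 5) := by decide

/-- For `z ∈ 𝔽₅` and odd `n`, `zⁿ = z^{n mod 4}` (Fermat's little theorem). [folklore] -/
private theorem pow_eq_pow_mod_four (z : ZMod 5) {n : ℕ} (hn : Odd n) : z ^ n = z ^ (n % 4) := by
  haveI : Fact (Nat.Prime 5) := ⟨by norm_num⟩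
  by_cases hz : z = 0
  · have h1 : n ≠ 0 := by obtain ⟨r, rfl⟩ := hn; omega
    have h2 : n % 4 ≠ 0 := by obtain ⟨r, rfl⟩ := hn; omega
    rw [hz, zero_pow h1, zero_pow h2]
  · conv_lhs => rw [← Nat.div_add_mod n 4, pow_add, pow_mul]
    have h4 : z ^ 4 = 1 := by
      have := ZMod.pow_card_sub_one_eq_one hz
      simpa using this
    rw [h4, one_pow, one_mul]

/-- The finite check in `𝔽₅`: for `A² ≠ 1` and `r ∈ {1, 3}`, `(A + 1)^r − (A − 1)^r ≠ −2`. [folklore] -/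
private theorem zmod_five_check : ∀ A : ZMod 5, A ^ 2 + 64 ≠ 0 →
    (A + 1) ^ 1 - (A - 1) ^ 1 ≠ -2 ∧ (A + 1) ^ 3 - (A - 1) ^ 3 ≠ -2 := by decide

/-- **The sign `−` is impossible.** There is no Gaussian integer `c = a − 8i` with `5 ∤ a² + 64`
such that `cⁿ = x + 8i` for an odd `n` (reduce by `ℤ[i] → 𝔽₅`, `i ↦ 2`: `(a+1)ⁿ − (a−1)ⁿ = −2`
with `a ≢ ±1 (mod 5)` is impossible). This replaces, for a PRIME value `a² + 64`, the mod-`q` sieve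
of [Cohn1993, §3] for the minus sign. [cite: Cohn1993, Lemma 4 and §3 (the minus sign)] -/
theorem false_of_pow_eq_neg {c : GaussianInt} {n : ℕ} {x : ℤ} (hb : c.im = -8)
    (h5 : ¬ (5 : ℤ) ∣ c.re ^ 2 + 64) (hn : Odd n) (hc : c ^ n = ⟨x, 8⟩) : False := by
  set φ : GaussianInt →+* ZMod 5 := Zsqrtd.lift ⟨2, two_mul_two_zmod_five⟩ with hφ
  have hφapply : ∀ z : GaussianInt, φ z = (z.re : ZMod 5) + (z.im : ZMod 5) * 2 := fun z ↦ by
    rw [hφ, Zsqrtd.lift_apply_apply]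
  have h16 : ((8 : ℤ) : ZMod 5) * 2 = 1 := by decide
  have h16' : ((-8 : ℤ) : ZMod 5) * 2 = -1 := by decide
  have hφc : φ c = (c.re : ZMod 5) - 1 := by
    rw [hφapply, hb, h16']; ring
  have hφcb : φ (star c) = (c.re : ZMod 5) + 1 := by
    rw [hφapply, Zsqrtd.re_star, Zsqrtd.im_star, hb, neg_neg, h16]
  have h1 : ((c.re : ZMod 5) - 1) ^ n = (x : ZMod 5) + 1 := by
    rw [← hφc, ← map_pow, hc, hφapply]
    simp only
    rw [h16]
  have h2 : ((c.re : ZMod 5) + 1) ^ n = (x : ZMod 5) - 1 := by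
    have hs : (star c) ^ n = ⟨x, -8⟩ := by rw [← star_pow, hc]; rfl
    rw [← hφcb, ← map_pow, hs, hφapply]
    simp only
    rw [h16']; ring
  have h3 : ((c.re : ZMod 5) + 1) ^ n - ((c.re : ZMod 5) - 1) ^ n = -2 := by
    rw [h1, h2]; ring
  rw [pow_eq_pow_mod_four _ hn, pow_eq_pow_mod_four _ hn] at h3
  have hA : (c.re : ZMod 5) ^ 2 + 64 ≠ 0 := by
    intro h0
    apply h5
    have : ((c.re ^ 2 + 64 : ℤ) : ZMod 5) = 0 := by push_cast; exact h0
    exact (ZMod.intCast_zmod_eq_zero_iff_dvd _ 5).mp this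
  have hr : n % 4 = 1 ∨ n % 4 = 3 := by obtain ⟨r, rfl⟩ := hn; omega
  obtain ⟨c1, c3⟩ := zmod_five_check _ hA
  rcases hr with hr | hr <;> rw [hr] at h3
  · exact c1 h3
  · exact c3 h3

end LebesgueNagell64

/-! ### The theorem -/

open LebesgueNagell64 in
/-- **The Lebesgue–Nagell equation `x² + 64 = pⁿ` for an odd prime `p`.** If `p` is an odd prime
and `x² + 64 = pⁿ` (`x ∈ ℤ`, `n ∈ ℕ`), then `n = 1`, or `n = 2` and `p = 17`. This is the case of
a prime-power value of Cohn's result that `x² + 64 = yⁿ`, `n ≥ 3`, has only the solution `x = 8`,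
`y = 2` [Cohn1993, §5]; it bounds the exponent of the discriminant `A² + 64 = pⁿ` in Setzer's
classification of elliptic curves of prime conductor with a rational `2`-torsion point
[Setzer1975]. The proof is the elementary one described in the module docstring (even `n` by
factoring; odd `n` by strong induction through `ℤ[i]`, a 2-adic computation for the sign `+` and
reduction modulo `5` for the sign `−`). [cite: Cohn1993, §5 (table: C = 64)] -/
theorem sq_add_sixtyfour_eq_prime_pow {p : ℕ} (hp : p.Prime) (hp2 : p ≠ 2) :
    ∀ (n : ℕ) (x : ℤ), x ^ 2 + 64 = (p : ℤ) ^ n → n = 1 ∨ (n = 2 ∧ p = 17) := by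
  intro n
  induction n using Nat.strong_induction_on with
  | _ n ih =>
  intro x h
  rcases Nat.even_or_odd n with ⟨m, hm⟩ | hodd
  · -- even exponent
    subst hm
    rcases Nat.eq_zero_or_pos m with rfl | hmpos
    · exfalso; simp at h; nlinarith [sq_nonneg x]
    · rw [← two_mul] at h
      obtain ⟨hm1, hp17⟩ := even_case hp hp2 h
      exact Or.inr ⟨by omega, hp17⟩
  · -- odd exponent
    by_cases hn1 : n = 1
    · exact Or.inl hn1
    exfalso
    have hn3 : 3 ≤ n := by obtain ⟨r, rfl⟩ := hodd; omega
    -- `p` and `x` are odd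
    have hpodd : Odd (p : ℤ) := by exact_mod_cast hp.odd_of_ne_two hp2
    have hxodd : Odd x := by
      have h1 : Odd ((p : ℤ) ^ n) := hpodd.pow
      rw [← h] at h1
      by_contra hx
      rw [Int.not_odd_iff_even] at hx
      exact (Int.not_even_iff_odd.mpr h1) ((hx.pow_of_ne_zero two_ne_zero).add ⟨32, by norm_num⟩)
    -- a prime factor `q` of `n` and its (odd) cofactor `k`
    have hqp : n.minFac.Prime := Nat.minFac_prime hn1
    obtain ⟨k, hk⟩ := Nat.minFac_dvd n
    have hqk : Odd n.minFac ∧ Odd k := by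
      have : Odd (n.minFac * k) := by rw [← hk]; exact hodd
      exact Nat.odd_mul.mp this
    have hk0 : 0 < k := by obtain ⟨r, hr⟩ := hqk.2; omega
    have hkn : k < n := by
      rw [hk]; exact (Nat.lt_mul_iff_one_lt_left hk0).mpr hqp.one_lt
    -- `x² + 64 = (p^k)^q`, so `x + 8i = c^q`
    have h' : x ^ 2 + 64 = ((p : ℤ) ^ k) ^ n.minFac := by
      rw [← pow_mul, mul_comm, ← hk]; exact h
    obtain ⟨c, hc⟩ := exists_pow_eq hxodd hqk.1 h'
    -- `a² + b² = p^k`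
    have hab : c.re ^ 2 + c.im ^ 2 = (p : ℤ) ^ k := by
      have h2 : (c.re ^ 2 + c.im ^ 2) ^ n.minFac = ((p : ℤ) ^ k) ^ n.minFac := by
        rw [norm_eq_of_pow_eq hc, h']
      exact (hqk.1.strictMono_pow (R := ℤ)).injective h2
    have hodd_ab : Odd (c.re ^ 2 + c.im ^ 2) := by rw [hab]; exact hpodd.pow
    obtain ⟨hb, ha⟩ := im_eq_of_pow_eq hqk.1 hxodd hc hodd_ab
    -- `a² + 64 = p^k`, so `k = 1` by induction (`k` is odd)
    have hak : c.re ^ 2 + 64 = (p : ℤ) ^ k := by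
      have e : c.im ^ 2 = 64 := by rcases hb with hh | hh <;> rw [hh] <;> norm_num
      rw [← e]; exact hab
    have hk1 : k = 1 := by
      rcases ih k hkn c.re hak with h1 | ⟨h2, -⟩
      · exact h1
      · exfalso; rw [h2] at hqk; exact (by decide : ¬ Odd 2) hqk.2
    rw [hk1, mul_one] at hk
    rw [hk1, pow_one] at hak
    -- `n = q` is an odd prime `≥ 3`, `c = a ± 8i`, `cⁿ = x + 8i`, `p = a² + 64`
    rw [← hk] at hc
    rcases hb with hb | hb
    · exact false_of_pow_eq_pos hb ha hodd hn3 hc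
    · refine false_of_pow_eq_neg hb ?_ hodd hc
      intro h5
      rw [hak] at h5
      have h5' : 5 ∣ p := by exact_mod_cast h5
      have hp5 : p = 5 := ((Nat.prime_dvd_prime_iff_eq (by norm_num) hp).mp h5').symm
      subst hp5
      have hak' : c.re ^ 2 + 64 = 5 := by exact_mod_cast hak
      nlinarith [sq_nonneg c.re]

end Literature.NumberTheory.DiophantineGeometry
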